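import Literature.NumberTheory.EllipticCurves.KolyvaginShaStructure
import Summits.BirchSwinnertonDyer.Rank1Residual.O5.HeegnerIndexThree
import HarnessLib

/-!
# O6/O5 rank one, `t = 0`: the SINGLE-CLASS certificate — one non-`3`-divisible derived Heegner
# point closes the `3`-part of BSD for `E` (rank `1`) AND for its Heegner twist (rank `0`,
# `Ш[3^∞]` of order `3^{2M₀}`), at ANY reduction type of `E` at `3` (cell `b2b-bsdres`, team o5o6,
# seat O6 planner 2 = `b2b-bsdres-o6-r2`; BOOKKEEPING THEOREMS over ONE named Literature fact;
# nothing asserted, nothing booked, no label changes)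

HONEST FRAMING (cell `b2b-bsdres`, verbatim): research routes; no claim beyond stated classes;
census output = EVIDENCE / conjecture items, never a Literature fact. This file adds NO conjecture:
it is the kernel glue of route R-O6-C0 of `cells/o5o6/TARGETS.md` §O6 (o6-r2), turning the tree's
named fact `McCallum1991_card_sha_primary_of_derivedPoint_not_divisible`
(`Literature/…/KolyvaginShaStructure.lean`: Kolyvagin 1991 / McCallum 1991 §1 Theorem, Thm. 5.4,
Thm. 5.8 — hypotheses `p` odd, `ρ̄_{E,p^n}` onto for all `n`, no CM, Heegner `K` with
`d_K ∉ {−3,−4}`, `y_K` of infinite order with `p^{M₀} ∥ y_K`, ONE Kolyvagin prime `ℓ` with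
`P_ℓ ∉ pE(K_ℓ)`; NO hypothesis on the reduction of `E` at `p`, NO `p ∤ N`, NO Manin constant, NO
Tamagawa condition) into the census currency `MissingPPartAt · 3` for BOTH members of the pair.

WHY THIS IS THE ROUTE FOR THE `t = 0` ROWS (EVIDENCE, census `hyp_bits.tsv` D2 v2 + kit job
j120807, 2026-08-21): every additive potentially-good rank-`1` X4 row at `p = 3` with
`3 ∤ ∏ c_q` that is still in the residue (26 wild + 37 tame rows, `N < 2·10⁴`) has `ord₃` of the
certified Heegner index equal to `1` on EVERY certified field (it is in the residue BECAUSE no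
field gave a `3`-unit index: Kolyvagin's inequality then only gives `ord₃ #Ш ≤ 2`), and the
analytic order of `Ш` of the corresponding rank-`0` twist is `9` on every such field (two engines:
impl-1 exact modular symbols, and PARI `ellanalyticrank`/`ellbsd`, 14/14 twists; the six control
twists of `t = 2` rows have `Ш_an = 1`). By Gross–Kohnen–Zagier the valuation of the index is the
same for every Heegner field with `3 ∤ c(|D|)`, so more fields will not help: these rows are
INDEX-LOCKED, and BSD predicts `M₀ = 1`, `M₁ = M_∞ = 0`, i.e. that SOME Kolyvagin prime `ℓ` has
`P_ℓ ∉ 3E(K_ℓ)`. Exhibiting one such `ℓ` (instrument: Jetchev–Lauter–Stein arXiv:0707.0032 §3–4,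
division-polynomial root test over `K[ℓ]`; census instrument E1-K / KOLY-DERIV1@3) feeds the fact
and yields, by the theorems below, `ord₃ #Ш(E) = 0` and `ord₃ #Ш(E^{(d_K)}) = 2M₀` — hence
`MissingPPartAt E 3` (given `3 ∤ #Ш_an(E)`, decided per row) and `MissingPPartAt E^{(d_K)} 3`
(given `ord₃ #Ш_an(E^{(d_K)}) = 2M₀`, decided per row), the latter a rank-`0` WILD-`3` curve with
`Ш[3^∞]` of order `9` beyond the census window (e.g. `3510a1 ⊗ χ_{−191}`, `N = 128 048 310`).
For rows with `3 ∣ ∏ c_q` (`t ≥ 1`) the certificate CANNOT fire if the refined Kolyvagin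
conjecture `M_∞ = t` (T-O6-C, `WildThreeRefinedKolyvagin.lean`) holds — there the class-level
input is the divisibility theorem, not a computation.

References: W. G. McCallum, LMS LN 153 (1991) §1 Theorem, Thm. 5.4, Cor. 5.6, Thm. 5.8
[McCallumLMS1991]; V. A. Kolyvagin, Math. Ann. 291 (1991) §§1–2 [Kolyvagin1991MathAnn];
B. H. Gross, LMS LN 153 (1991) Conj. 1.2, Prop. 5.3 [GrossLMS1991]; D. Jetchev, K. Lauter,
W. Stein, arXiv:0707.0032 Props. 3.10, 4.1, 4.2; Miller 2011 Def. 1.1 [Miller2011LMS].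
-/

noncomputable section

open scoped Classical

open WeierstrassCurve Literature.NumberTheory.EllipticCurves
  Literature.NumberTheory.EllipticCurves.ModularForms
  Literature.NumberTheory.EllipticCurves.Rank1Residual
  Literature.NumberTheory.EllipticCurves.Rank1Residual.Typed

namespace Summit.BirchSwinnertonDyer.Rank1Residual.AdditiveThree

/-- **The single-class certificate, orders.** Granted McCallum's exact-order fact (`h`) and
Gross–Zagier–Kolyvagin (`hGZK`, to know both `Ш` finite): for a rank-one `E` (`w(E/ℚ) = −1`,
analytic rank `≤ 1`), a Heegner `K`, `3`-adic tower surjectivity, `3^{M₀} ∥ y_K` and ONE Kolyvagin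
prime `ℓ` with `P_ℓ ∉ 3E(K_ℓ)`: `ord₃ #Ш(E/ℚ) = 0` and `ord₃ #Ш(E^{(d_K)}/ℚ) = 2M₀`.
Bookkeeping over the fact. [cite: McCallumLMS1991, §1 Theorem (Kolyvagin) (p. 296) and §5 Thm. 5.4, Thm. 5.8 (pp. 308–310)] -/
theorem padicValNat_shaOrder_pair_of_derivedPoint_not_divisible
    (h : McCallum1991_card_sha_primary_of_derivedPoint_not_divisible)
    (hGZK : rank_eq_analyticRank_of_analyticRank_le_one)
    (W : WeierstrassCurve ℚ) [W.IsElliptic] [W.IsGloballyMinimal] [NeZero (W.conductorNorm ℤ)]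
    (hCM : ¬ W.HasCM) (hr : W.analyticRank ≤ 1) (hw : W.rootNumber = -1)
    (K : Type) [Field K] [NumberField K] (hK : IsImaginaryQuadratic K)
    (hD3 : NumberField.discr K ≠ -3) (hD4 : NumberField.discr K ≠ -4)
    (hH : SatisfiesHeegnerHypothesis (W.conductorNorm ℤ) K)
    (htower : ∀ n : ℕ, W.HasSurjectiveModNGaloisRep (3 ^ n : ℕ))
    (Dt : ModularParametrizationData W (W.conductorNorm ℤ)) (β : ℤ) (ι : K →+* ℂ)
    (d₁ : KolyvaginHeegnerData Dt β ι 1) (hy : ¬ IsOfFinAddOrder d₁.derivedPoint) (M₀ : ℕ)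
    (hdiv : ∃ Q : (W.baseChange (ringClassField K ι 1)).toAffine.Point,
      ((3 ^ M₀ : ℕ) : ℤ) • Q = d₁.derivedPoint)
    (hndiv : ¬ ∃ Q : (W.baseChange (ringClassField K ι 1)).toAffine.Point,
      ((3 ^ (M₀ + 1) : ℕ) : ℤ) • Q = d₁.derivedPoint)
    (ℓ : ℕ) (d : KolyvaginHeegnerData Dt β ι ℓ)
    (hℓ : Zhang2014.IsKolyvaginPrime (W.conductorNorm ℤ) W K 3 ℓ)
    (hP : ¬ ∃ Q : (W.baseChange (ringClassField K ι ℓ)).toAffine.Point, (3 : ℤ) • Q = d.derivedPoint)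
    (Wd : WeierstrassCurve ℚ) [Wd.IsElliptic]
    (hWd : ∃ C : VariableChange ℚ, C • W.quadraticTwist (NumberField.discr K : ℚ) = Wd)
    (hrD : Wd.analyticRank ≤ 1) :
    padicValNat 3 W.shaOrder = 0 ∧ padicValNat 3 Wd.shaOrder = 2 * M₀ := by
  haveI : Fact (Nat.Prime 3) := ⟨Nat.prime_three⟩
  haveI : Finite W.sha := (hGZK W hr).2
  haveI : Finite Wd.sha := (hGZK Wd hrD).2
  have hfact := h W hCM K hK hD3 hD4 hH 3 (by norm_num) htower Dt β ι d₁ hy M₀ hdiv hndiv ℓ d hℓ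
    (by exact_mod_cast hP) Wd hWd
  obtain ⟨hE, hEd⟩ := hfact.2.2 hw
  refine ⟨?_, ?_⟩
  · have := padicValNat_card_addPrimaryComponent (A := W.sha) 3
    rw [hE] at this
    simpa [WeierstrassCurve.shaOrder] using this.symm
  · have := padicValNat_card_addPrimaryComponent (A := Wd.sha) 3
    rw [hEd, padicValNat.prime_pow] at this
    simpa [WeierstrassCurve.shaOrder] using this.symm

/-- **Route R-O6-C0, rank-one member.** With `3 ∤ #Ш_an(E)` (census, decided per row: `hq`, `hq3`)
the certificate gives `MissingPPartAt W 3`. [cite: Miller2011LMS, Def. 1.1 (arXiv:1010.2431 p. 3)] -/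
theorem missingPPartAt_three_of_derivedPoint_not_divisible
    (h : McCallum1991_card_sha_primary_of_derivedPoint_not_divisible)
    (hGZK : rank_eq_analyticRank_of_analyticRank_le_one)
    (W : WeierstrassCurve ℚ) [W.IsElliptic] [W.IsGloballyMinimal] [NeZero (W.conductorNorm ℤ)]
    (hCM : ¬ W.HasCM) (hr : W.analyticRank ≤ 1) (hw : W.rootNumber = -1)
    {q : ℚ} (hq : shaAn W = (q : ℂ)) (hq3 : padicValRat 3 q = 0)
    (K : Type) [Field K] [NumberField K] (hK : IsImaginaryQuadratic K)
    (hD3 : NumberField.discr K ≠ -3) (hD4 : NumberField.discr K ≠ -4)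
    (hH : SatisfiesHeegnerHypothesis (W.conductorNorm ℤ) K)
    (htower : ∀ n : ℕ, W.HasSurjectiveModNGaloisRep (3 ^ n : ℕ))
    (Dt : ModularParametrizationData W (W.conductorNorm ℤ)) (β : ℤ) (ι : K →+* ℂ)
    (d₁ : KolyvaginHeegnerData Dt β ι 1) (hy : ¬ IsOfFinAddOrder d₁.derivedPoint) (M₀ : ℕ)
    (hdiv : ∃ Q : (W.baseChange (ringClassField K ι 1)).toAffine.Point,
      ((3 ^ M₀ : ℕ) : ℤ) • Q = d₁.derivedPoint)
    (hndiv : ¬ ∃ Q : (W.baseChange (ringClassField K ι 1)).toAffine.Point,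
      ((3 ^ (M₀ + 1) : ℕ) : ℤ) • Q = d₁.derivedPoint)
    (ℓ : ℕ) (d : KolyvaginHeegnerData Dt β ι ℓ)
    (hℓ : Zhang2014.IsKolyvaginPrime (W.conductorNorm ℤ) W K 3 ℓ)
    (hP : ¬ ∃ Q : (W.baseChange (ringClassField K ι ℓ)).toAffine.Point, (3 : ℤ) • Q = d.derivedPoint) :
    MissingPPartAt W 3 := by
  haveI : (W.quadraticTwist (NumberField.discr K : ℚ)).IsElliptic :=
    W.isElliptic_quadraticTwist (by exact_mod_cast NumberField.discr_ne_zero K)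
  -- the twist has analytic rank ≤ 1 is NOT needed for the `E`-side conclusion of the fact; we use
  -- the fact directly (orders of the primary components) and finiteness of `Ш(E)` from `hGZK`.
  haveI : Fact (Nat.Prime 3) := ⟨Nat.prime_three⟩
  haveI : Finite W.sha := (hGZK W hr).2
  have hfact := h W hCM K hK hD3 hD4 hH 3 (by norm_num) htower Dt β ι d₁ hy M₀ hdiv hndiv ℓ d hℓ
    (by exact_mod_cast hP) (W.quadraticTwist (NumberField.discr K : ℚ)) ⟨1, one_smul _ _⟩
  have hE := (hfact.2.2 hw).1
  have hval : padicValNat 3 W.shaOrder = 0 := by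
    have := padicValNat_card_addPrimaryComponent (A := W.sha) 3
    rw [hE] at this
    simpa [WeierstrassCurve.shaOrder] using this.symm
  exact ⟨q, hq, by rw [hval, hq3]; simp⟩

/-- **Route R-O6-C0, rank-zero member (the Heegner twist, a wild-`3` curve with `Ш[3^∞]` of order
`3^{2M₀}`).** With `ord₃ #Ш_an(E^{(d_K)}) = 2M₀` (census, decided per twist — e.g. kit job j120807:
`#Ш_an = 9`, `M₀ = 1`) the same certificate gives `MissingPPartAt Wd 3`.
[cite: Miller2011LMS, Def. 1.1 (arXiv:1010.2431 p. 3)] -/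
theorem missingPPartAt_three_twist_of_derivedPoint_not_divisible
    (h : McCallum1991_card_sha_primary_of_derivedPoint_not_divisible)
    (hGZK : rank_eq_analyticRank_of_analyticRank_le_one)
    (W : WeierstrassCurve ℚ) [W.IsElliptic] [W.IsGloballyMinimal] [NeZero (W.conductorNorm ℤ)]
    (hCM : ¬ W.HasCM) (hr : W.analyticRank ≤ 1) (hw : W.rootNumber = -1)
    (K : Type) [Field K] [NumberField K] (hK : IsImaginaryQuadratic K)
    (hD3 : NumberField.discr K ≠ -3) (hD4 : NumberField.discr K ≠ -4)
    (hH : SatisfiesHeegnerHypothesis (W.conductorNorm ℤ) K)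
    (htower : ∀ n : ℕ, W.HasSurjectiveModNGaloisRep (3 ^ n : ℕ))
    (Dt : ModularParametrizationData W (W.conductorNorm ℤ)) (β : ℤ) (ι : K →+* ℂ)
    (d₁ : KolyvaginHeegnerData Dt β ι 1) (hy : ¬ IsOfFinAddOrder d₁.derivedPoint) (M₀ : ℕ)
    (hdiv : ∃ Q : (W.baseChange (ringClassField K ι 1)).toAffine.Point,
      ((3 ^ M₀ : ℕ) : ℤ) • Q = d₁.derivedPoint)
    (hndiv : ¬ ∃ Q : (W.baseChange (ringClassField K ι 1)).toAffine.Point,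
      ((3 ^ (M₀ + 1) : ℕ) : ℤ) • Q = d₁.derivedPoint)
    (ℓ : ℕ) (d : KolyvaginHeegnerData Dt β ι ℓ)
    (hℓ : Zhang2014.IsKolyvaginPrime (W.conductorNorm ℤ) W K 3 ℓ)
    (hP : ¬ ∃ Q : (W.baseChange (ringClassField K ι ℓ)).toAffine.Point, (3 : ℤ) • Q = d.derivedPoint)
    (Wd : WeierstrassCurve ℚ) [Wd.IsElliptic]
    (hWd : ∃ C : VariableChange ℚ, C • W.quadraticTwist (NumberField.discr K : ℚ) = Wd)
    (hrD : Wd.analyticRank ≤ 1)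
    {q₁ : ℚ} (hq₁ : shaAn Wd = (q₁ : ℂ)) (hq₁3 : padicValRat 3 q₁ = 2 * M₀) :
    MissingPPartAt Wd 3 := by
  have hval := (padicValNat_shaOrder_pair_of_derivedPoint_not_divisible h hGZK W hCM hr hw K hK hD3
    hD4 hH htower Dt β ι d₁ hy M₀ hdiv hndiv ℓ d hℓ hP Wd hWd hrD).2
  exact ⟨q₁, hq₁, by rw [hval, hq₁3]; push_cast; ring⟩

end Summit.BirchSwinnertonDyer.Rank1Residual.AdditiveThree

end
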